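import Literature.MathematicalPhysics.StatisticalMechanics.LocalMatchingCompactness
import Summits.AtomisticToContinuum.Crystallization.Theorems.HullExactificationCascadeHullGoodEverywhereSnap

/-!
# Crux `GappedShellCensus.CleanLimitExtraction` (stmt-AtomisticToContinuum-15933), line `Sketch` —
# stub `stub_cleGappedOfLimit` (closedness A: gapped-twelve passes to local limits)

Setting: `δ`-separated point sets `Ys k ⊆ ℝ³` converging locally to a `δ`-separated `S`
(`BallMatch ε R 0 (Ys k) S` eventually, for all `R` and all `ε > 0`), approximants `p k ∈ Ys k`
with `p k → y`, and every `p k` GAPPED-TWELVE at scale `a > 0` in `Ys k`: exactly twelve other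
points in the closed bond shell `dist ≤ 1.02 a`, no other point closer than `0.98 a`, none in the
open annulus `(1.02 a, 1.26 a)`.  Conclusion: `y` is gapped-twelve at scale `a` in `S`.

Proof (the moves of `hge_patternGood_of_limit`, for this goodness notion).  Label the shell of
`p k` by `Fin 12` (`ncard = 12`), extract one subsequence `ψ` along which the twelve bounded
offsets converge (`hge_extract_bounded`), and check: the twelve limits lie in `S`
(`hge_mem_of_tendsto`), stay `≥ δ` away from `y` and from each other (`hge_le_dist_of_tendsto`),
and stay in the closed shell; conversely every point `z ∈ S ∖ {y}` is followed back along
`nearPt (Ys (ψ k)) z → z` (`hge_exists_approx`): the closed radial conditions pass to the limit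
(for the disjunction, both alternatives cannot fail eventually), and if `dist y z ≤ 1.02 a` then
eventually the approximant is in the shell of `p (ψ k)`, hence carries a fixed label frequently
(`hge_frequently_exists_of_finite`), so `z` is one of the twelve limits.  Hence the limit shell is
the range of an injective map from `Fin 12`.
-/

noncomputable section

namespace Summit.AtomisticToContinuum.Crystallization.Theorems

open Filter Topology Metric
open Literature.MathematicalPhysics.StatisticalMechanics Literature.Geometry.DiscreteGeometry

/-- Labelling a set of `ncard = 12` by `Fin 12`: it is the range of an injective map. -/
private theorem cleA_label {s : Set (EuclideanSpace ℝ (Fin 3))} (hs : s.ncard = 12) :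
    ∃ q : Fin 12 → EuclideanSpace ℝ (Fin 3), Function.Injective q ∧ Set.range q = s := by
  classical
  have hfin : s.Finite := Set.finite_of_ncard_pos (by rw [hs]; norm_num)
  have hcard : hfin.toFinset.card = 12 := by rw [← Set.ncard_eq_toFinset_card s hfin, hs]
  refine ⟨fun i => ((Finset.equivFinOfCardEq hcard).symm i : EuclideanSpace ℝ (Fin 3)),
    Subtype.val_injective.comp (Finset.equivFinOfCardEq hcard).symm.injective, ?_⟩
  ext x
  refine ⟨?_, fun hx => ⟨Finset.equivFinOfCardEq hcard ⟨x, hfin.mem_toFinset.2 hx⟩, by simp⟩⟩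
  rintro ⟨i, rfl⟩
  exact hfin.mem_toFinset.1 ((Finset.equivFinOfCardEq hcard).symm i).2

/-- **Closedness A: gapped-twelve passes to local limits.**  Along `δ`-separated sets `Ys k`
converging locally to the `δ`-separated `S`, if `p k ∈ Ys k` converge to `y` and every `p k` is
gapped-twelve at scale `a > 0` in `Ys k` (twelve points in the closed bond shell
`[0.98 a, 1.02 a]`, nothing closer, nothing in the open annulus `(1.02 a, 1.26 a)`), then `y` is
gapped-twelve at scale `a` in `S`. -/
theorem stub_cleGappedOfLimit
    {Ys : ℕ → Set (EuclideanSpace ℝ (Fin 3))} {S : Set (EuclideanSpace ℝ (Fin 3))} {δ a : ℝ}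
    (hδ : 0 < δ) (ha : 0 < a)
    (hYsep : ∀ k, ∀ p ∈ Ys k, ∀ q ∈ Ys k, p ≠ q → δ ≤ dist p q)
    (hSsep : ∀ p ∈ S, ∀ q ∈ S, p ≠ q → δ ≤ dist p q)
    (hlim : ∀ R ε : ℝ, 0 < ε → ∀ᶠ k in Filter.atTop, BallMatch ε R 0 (Ys k) S)
    {y : EuclideanSpace ℝ (Fin 3)} {p : ℕ → EuclideanSpace ℝ (Fin 3)}
    (hpY : ∀ k, p k ∈ Ys k) (hpy : Filter.Tendsto p Filter.atTop (nhds y))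
    (hgood : ∀ k, {w ∈ Ys k | w ≠ p k ∧ dist (p k) w ≤ a * (1 + 1 / 50)}.ncard = 12 ∧
      ∀ w ∈ Ys k, w ≠ p k → a * (1 - 1 / 50) ≤ dist (p k) w ∧
        (dist (p k) w ≤ a * (1 + 1 / 50) ∨ a * (63 / 50) ≤ dist (p k) w)) :
    {w ∈ S | w ≠ y ∧ dist y w ≤ a * (1 + 1 / 50)}.ncard = 12 ∧
      ∀ w ∈ S, w ≠ y → a * (1 - 1 / 50) ≤ dist y w ∧
        (dist y w ≤ a * (1 + 1 / 50) ∨ a * (63 / 50) ≤ dist y w) := by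
  classical
  -- Step A: label the twelve shell points of every `p k`
  have hlab : ∀ k, ∃ q : Fin 12 → EuclideanSpace ℝ (Fin 3), Function.Injective q ∧
      Set.range q = {w ∈ Ys k | w ≠ p k ∧ dist (p k) w ≤ a * (1 + 1 / 50)} :=
    fun k => cleA_label (hgood k).1
  choose q hinj hrange using hlab
  have hq : ∀ k i, q k i ∈ Ys k ∧ q k i ≠ p k ∧ dist (p k) (q k i) ≤ a * (1 + 1 / 50) :=
    fun k i => by
      have h : q k i ∈ Set.range (q k) := Set.mem_range_self i
      rw [hrange k] at h
      exact h
  have hsurj : ∀ k, ∀ w ∈ Ys k, w ≠ p k → dist (p k) w ≤ a * (1 + 1 / 50) → ∃ i, q k i = w :=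
    fun k w hw hne hd => by
      have h : w ∈ Set.range (q k) := by rw [hrange k]; exact ⟨hw, hne, hd⟩
      exact Set.mem_range.1 h
  -- Step B: one subsequence along which the twelve (bounded) offsets converge
  obtain ⟨ψ, _, wlim, hψ, -, -, hwconv⟩ :=
    hge_extract_bounded (ι := Fin 12) (a := 0) (b := 0) (C := a * (1 + 1 / 50))
      (fun _ => (0 : ℝ)) (fun k i => q k i - p k) (fun _ => ⟨le_rfl, le_rfl⟩)
      (fun k i => by rw [← dist_eq_norm, dist_comm]; exact (hq k i).2.2)
  have hlimψ : ∀ R ε : ℝ, 0 < ε → ∀ᶠ k in atTop, BallMatch ε R 0 (Ys (ψ k)) S :=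
    fun R ε hε => hψ.tendsto_atTop.eventually (hlim R ε hε)
  have hYsepψ : ∀ k, ∀ p ∈ Ys (ψ k), ∀ q ∈ Ys (ψ k), p ≠ q → δ ≤ dist p q := fun k => hYsep (ψ k)
  have hpψ : Tendsto (fun k => p (ψ k)) atTop (𝓝 y) := hpy.comp hψ.tendsto_atTop
  set qlim : Fin 12 → EuclideanSpace ℝ (Fin 3) := fun i => wlim i + y with hqlim_def
  have hqψ : ∀ i, Tendsto (fun k => q (ψ k) i) atTop (𝓝 (qlim i)) := fun i => by
    have h := (hwconv i).add hpψ
    simpa [sub_add_cancel] using h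
  -- (a) the twelve limits lie in `S`
  have hqS : ∀ i, qlim i ∈ S := fun i =>
    hge_mem_of_tendsto hδ hSsep hlimψ (Eventually.of_forall fun k => (hq (ψ k) i).1) (hqψ i)
  -- (b) they differ from `y`
  have hqy : ∀ i, qlim i ≠ y := fun i h => by
    have h1 : δ ≤ dist (qlim i) y :=
      hge_le_dist_of_tendsto (hqψ i) hpψ (Eventually.of_forall fun k =>
        hYsep _ _ (hq (ψ k) i).1 _ (hpY _) (hq (ψ k) i).2.1).frequently
    rw [h, dist_self] at h1
    linarith
  -- (c) they lie in the closed bond shell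
  have hqd : ∀ i, dist y (qlim i) ≤ a * (1 + 1 / 50) := fun i =>
    le_of_tendsto' (hpψ.dist (hqψ i)) fun k => (hq (ψ k) i).2.2
  -- (d) distinct labels give distinct limits
  have hinjlim : Function.Injective qlim := fun i j hij => by
    by_contra hne
    have hsep : δ ≤ dist (qlim i) (qlim j) :=
      hge_le_dist_of_tendsto (hqψ i) (hqψ j) (Eventually.of_forall fun k =>
        hYsep _ _ (hq (ψ k) i).1 _ (hq (ψ k) j).1 (fun h => hne (hinj _ h))).frequently
    rw [hij, dist_self] at hsep
    linarith
  -- (e) follow every other point of `S` back along approximants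
  have hback : ∀ z ∈ S, z ≠ y →
      (a * (1 - 1 / 50) ≤ dist y z ∧ (dist y z ≤ a * (1 + 1 / 50) ∨ a * (63 / 50) ≤ dist y z)) ∧
        (dist y z ≤ a * (1 + 1 / 50) → ∃ i, qlim i = z) := by
    intro z hz hzy
    obtain ⟨hbmem, hbz⟩ := hge_exists_approx hδ hYsepψ hlimψ hz
    set b : ℕ → EuclideanSpace ℝ (Fin 3) := fun k => nearPt (Ys (ψ k)) z with hb_def
    have hdist : Tendsto (fun k => dist (p (ψ k)) (b k)) atTop (𝓝 (dist y z)) := hpψ.dist hbz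
    have hzy0 : 0 < dist y z := dist_pos.2 (Ne.symm hzy)
    have hne : ∀ᶠ k in atTop, b k ≠ p (ψ k) := by
      filter_upwards [hdist.eventually_const_lt (half_lt_self hzy0)] with k hk h
      rw [h, dist_self] at hk
      linarith
    have hgoodk : ∀ᶠ k in atTop, a * (1 - 1 / 50) ≤ dist (p (ψ k)) (b k) ∧
        (dist (p (ψ k)) (b k) ≤ a * (1 + 1 / 50) ∨ a * (63 / 50) ≤ dist (p (ψ k)) (b k)) := by
      filter_upwards [hbmem, hne] with k hk1 hk2
      exact (hgood (ψ k)).2 (b k) hk1 hk2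
    refine ⟨⟨ge_of_tendsto hdist (hgoodk.mono fun k hk => hk.1), ?_⟩, fun hle => ?_⟩
    · by_contra hcon
      push Not at hcon
      obtain ⟨k, hk, hk1, hk2⟩ := (hgoodk.and ((hdist.eventually_const_lt hcon.1).and
        (hdist.eventually_lt_const hcon.2))).exists
      rcases hk.2 with h | h
      · exact absurd h (not_le.2 hk1)
      · exact absurd h (not_le.2 hk2)
    · have hlt : dist y z < a * (63 / 50) := by linarith
      have hev : ∀ᶠ k in atTop, ∃ i, q (ψ k) i = b k := by
        filter_upwards [hbmem, hne, hgoodk, hdist.eventually_lt_const hlt] with k hk1 hk2 hk3 hk4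
        refine hsurj _ _ hk1 hk2 ?_
        rcases hk3.2 with h | h
        · exact h
        · exact absurd h (not_le.2 hk4)
      obtain ⟨i, hi⟩ := hge_frequently_exists_of_finite hev
      exact ⟨i, tendsto_nhds_unique_of_frequently_eq (hqψ i) hbz hi⟩
  -- assemble: the limit shell is the range of the injective `qlim`
  refine ⟨?_, fun w hw hwy => (hback w hw hwy).1⟩
  have hset : {w ∈ S | w ≠ y ∧ dist y w ≤ a * (1 + 1 / 50)} = Set.range qlim := by
    ext w
    constructor
    · rintro ⟨hw, hwy, hwd⟩
      exact (hback w hw hwy).2 hwd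
    · rintro ⟨i, rfl⟩
      exact ⟨hqS i, hqy i, hqd i⟩
  rw [hset, Set.ncard_range_of_injective hinjlim, Nat.card_eq_fintype_card, Fintype.card_fin]

end Summit.AtomisticToContinuum.Crystallization.Theorems

end
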